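import Summits.QuantumFields.YangMills.Theorems.BalabanLadderNTClassicalShadowReflectionBox
import HarnessLib

/-!
# Crux `NT` (stmt-QuantumFields-19353), stub `stub_refpkgT : RefPkgT`: THE CLASSICAL SHADOW, IX — how the midplane reflections of a cube
# act on the single-plane fields (the bookkeeping an orbit-sum computation needs)

Helper file (`--supports stmt-QuantumFields-19353`) of the fleet lead prover of crux `NT` (unit `ym-spine-19353-p1`, GEN 15); sequel of
`…ClassicalShadowReflectionBox` (this generation: `boxTimeReflect`, `boxAxisReflect`, their kernel covariance and (S)).

The orbit test (`tendsto_kerCov_of_orbit`, `orbitCov_le_of_e2osc[_depthOne]`, `ClassicalOrbitCovFloorUnbounded`) needs the orbit SUMS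
`Σᵢ dens_x(γᵢ U)` on ground states, i.e. the values of the corner density after each symmetry.  The corner density is a sum of single-plane
fields `plane q x` (`dens_eq_sum_plane`), and a reflection does NOT act on them by a site map alone: spatial plaquettes go to the mirror
site, temporal ones to the mirror site shifted by `−e₀` (orientation reversal).  This file records the rules for the MIDPLANE time
reflection `R = boxTimeReflect c b` of an arbitrary cube:

* `boxSite c b x` — the mirror site `x₀ ↦ 2c₀ + b − 1 − x₀` (spatial coordinates unchanged), an involution (`boxSite_boxSite`);
* `plaquetteObs_configShift_sub` — translations act on plaquette observables by the site map `x ↦ x − v`;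
* **`plaquetteObs_boxTimeReflect_spatial`** / `plane_boxTimeReflect_spatial`: `plane (i,j) x (R U) = plane (i,j) (boxSite c b x) U` for `i, j ≠ 0`;
* **`plaquetteObs_boxTimeReflect_temporal`** / `plane_boxTimeReflect_temporal`: `plane (0,j) x (R U) = plane (0,j) (boxSite c b x − e₀) U`, `j ≠ 0`;
* **`dens_boxTimeReflect`** — the corner density after `R`: three temporal plaquettes one step below the mirror site plus three spatial
  plaquettes at the mirror site (so `dens ∘ R` is NOT `dens ∘ boxSite`: the orbit sums of the orbit test must be formed plane by plane).

(The axis-`k` reflection `boxAxisReflect k c b` is the `0 ↔ k` conjugate; its rules follow by `plane_perm`.)  Pure bookkeeping over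
`plaquetteObs_cfgReflect_spatial/temporal` (p604593) and `plaquetteHolonomyZd_configShift_add`; nothing about ground states; not NT; not Clay.
-/

set_option autoImplicit false

noncomputable section

open MeasureTheory Filter Topology
open Literature.MathematicalPhysics.QuantumFieldTheory Literature.MathematicalPhysics.QuantumLattice
open Literature.Probability.LatticeModels
open Summit.QuantumFields.YangMills.Cruxes.OSLegsFromFemtoAndGap.DlrCollarTransfer
open Summit.QuantumFields.YangMills.Cruxes.NT.BoundaryLaw (plane_eq_plaquetteObs)

namespace Summit.QuantumFields.YangMills.Cruxes.NT.ClassicalShadow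

/-! ## §1 The mirror site of the midplane time reflection -/

section Sites

/-- The mirror site of `x` under the midplane time reflection of the cube `(c, b)`: `x₀ ↦ 2c₀ + b − 1 − x₀`. -/
def boxSite (c : Fin 4 → ℤ) (b : ℕ) (x : Fin 4 → ℤ) : Fin 4 → ℤ :=
  Function.update x 0 (2 * c 0 + b - 1 - x 0)

/-- `boxSite` at the time coordinate. [folklore] -/
@[simp] theorem boxSite_zero (c : Fin 4 → ℤ) (b : ℕ) (x : Fin 4 → ℤ) : boxSite c b x 0 = 2 * c 0 + b - 1 - x 0 := by
  simp [boxSite]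

/-- `boxSite` at a spatial coordinate. [folklore] -/
@[simp] theorem boxSite_of_ne (c : Fin 4 → ℤ) (b : ℕ) (x : Fin 4 → ℤ) {j : Fin 4} (hj : j ≠ 0) : boxSite c b x j = x j := by
  simp [boxSite, hj]

/-- `boxSite` is an involution. [folklore] -/
theorem boxSite_boxSite (c : Fin 4 → ℤ) (b : ℕ) (x : Fin 4 → ℤ) : boxSite c b (boxSite c b x) = x := by
  funext j
  by_cases hj : j = 0
  · subst hj; simp only [boxSite_zero]; ring
  · simp only [boxSite_of_ne _ _ _ hj]

/-- The mirror site is `θ(x − (2c₀+b−1)e₀)`. [folklore] -/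
theorem siteReflect_sub_single_eq_boxSite (c : Fin 4 → ℤ) (b : ℕ) (x : Fin 4 → ℤ) :
    siteReflect (x - Pi.single 0 (2 * c 0 + b - 1)) = boxSite c b x := by
  funext j
  by_cases hj : j = 0
  · subst hj; simp only [siteReflect_apply_zero, Pi.sub_apply, Pi.single_eq_same, boxSite_zero]; ring
  · simp only [siteReflect_apply_of_ne _ hj, Pi.sub_apply, Pi.single_eq_of_ne hj, sub_zero, boxSite_of_ne _ _ _ hj]

/-- The midplane time reflection maps cube sites to cube sites (and preserves the depth coordinate ranges). [folklore] -/
theorem boxSite_mem_cubeSites {c : Fin 4 → ℤ} {b : ℕ} {x : Fin 4 → ℤ} (hx : x ∈ cubeSites c b) : boxSite c b x ∈ cubeSites c b := by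
  rw [Summit.QuantumFields.YangMills.Cruxes.OSLegsFromFemtoAndGap.DlrCollarTransfer.StubLower.mem_cubeSites_iff] at hx ⊢
  intro j
  by_cases hj : j = 0
  · subst hj
    have a := hx 0
    simp only [boxSite_zero]
    constructor <;> omega
  · simp only [boxSite_of_ne _ _ _ hj]
    exact hx j

end Sites

/-! ## §2 Plaquette observables under translations and under the midplane time reflection -/

section Planes

variable {G : Type} [Group G] [TopologicalSpace G] [IsTopologicalGroup G] [CompactSpace G]
  [MeasurableSpace G] [BorelSpace G] (r : LatticeRep G)

omit [TopologicalSpace G] [IsTopologicalGroup G] [CompactSpace G] [BorelSpace G] in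
/-- Translations act on plaquette observables by the site map `x ↦ x − v`. [folklore] -/
theorem plaquetteObs_configShift_sub {N : ℕ} (ρ : G →* Matrix (Fin N) (Fin N) ℂ) (v x : Site 4) (i j : Fin 4) (U : LGConfig 4 G) :
    plaquetteObs ρ x i j (Literature.MathematicalPhysics.QuantumLattice.configShift v U) = plaquetteObs ρ (x - v) i j U := by
  unfold plaquetteObs
  have h := plaquetteHolonomyZd_configShift_add v U (x - v) i j
  rw [sub_add_cancel] at h
  rw [h]

omit [IsTopologicalGroup G] [CompactSpace G] [BorelSpace G] in
/-- **Spatial plaquettes under the midplane time reflection**: `Re tr ρ((RU)_{p_{ij}(x)}) = Re tr ρ(U_{p_{ij}(boxSite c b x)})` (`i, j ≠ 0`).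
[folklore] -/
theorem plaquetteObs_boxTimeReflect_spatial (c : Fin 4 → ℤ) (b : ℕ) {i j : Fin 4} (hi : i ≠ 0)
    (hj : j ≠ 0) (x : Fin 4 → ℤ) (U : LGConfig 4 G) :
    plaquetteObs r.ρ x i j (boxTimeReflect c b U) = plaquetteObs r.ρ (boxSite c b x) i j U := by
  show plaquetteObs r.ρ x i j (Literature.MathematicalPhysics.QuantumLattice.configShift (Pi.single 0 (2 * c 0 + (b : ℤ) - 1))
    (cfgReflect U)) = plaquetteObs r.ρ (boxSite c b x) i j U
  rw [plaquetteObs_configShift_sub, plaquetteObs_cfgReflect_spatial r.ρ hi hj, siteReflect_sub_single_eq_boxSite]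

omit [BorelSpace G] in
/-- **Temporal plaquettes under the midplane time reflection**: `Re tr ρ((RU)_{p_{0j}(x)}) = Re tr ρ(U_{p_{0j}(boxSite c b x − e₀)})`
(`j ≠ 0`): the reflected temporal plaquette based at `x` is the temporal plaquette based ONE STEP BELOW the mirror site. [folklore] -/
theorem plaquetteObs_boxTimeReflect_temporal (c : Fin 4 → ℤ) (b : ℕ) {j : Fin 4} (hj : j ≠ 0)
    (x : Fin 4 → ℤ) (U : LGConfig 4 G) :
    plaquetteObs r.ρ x 0 j (boxTimeReflect c b U) = plaquetteObs r.ρ (boxSite c b x - Pi.single 0 1) 0 j U := by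
  show plaquetteObs r.ρ x 0 j (Literature.MathematicalPhysics.QuantumLattice.configShift (Pi.single 0 (2 * c 0 + (b : ℤ) - 1))
    (cfgReflect U)) = plaquetteObs r.ρ (boxSite c b x - Pi.single 0 1) 0 j U
  rw [plaquetteObs_configShift_sub, plaquetteObs_cfgReflect_temporal r.ρ r.continuous hj, siteReflect_sub_single_eq_boxSite]

omit [IsTopologicalGroup G] [CompactSpace G] [BorelSpace G] in
/-- **Spatial planes under the midplane time reflection**: `plane (i,j) x (R U) = plane (i,j) (boxSite c b x) U` (`i, j ≠ 0`). [folklore] -/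
theorem plane_boxTimeReflect_spatial (c : Fin 4 → ℤ) (b : ℕ) {i j : Fin 4} (hi : i ≠ 0) (hj : j ≠ 0)
    (x : Fin 4 → ℤ) (U : LGConfig 4 G) :
    plane G r (i, j) x (boxTimeReflect c b U) = plane G r (i, j) (boxSite c b x) U := by
  rw [plane_eq_plaquetteObs G r, plane_eq_plaquetteObs G r]
  exact plaquetteObs_boxTimeReflect_spatial r c b hi hj x U

omit [BorelSpace G] in
/-- **Temporal planes under the midplane time reflection**: `plane (0,j) x (R U) = plane (0,j) (boxSite c b x − e₀) U` (`j ≠ 0`). [folklore] -/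
theorem plane_boxTimeReflect_temporal (c : Fin 4 → ℤ) (b : ℕ) {j : Fin 4} (hj : j ≠ 0)
    (x : Fin 4 → ℤ) (U : LGConfig 4 G) :
    plane G r (0, j) x (boxTimeReflect c b U) = plane G r (0, j) (boxSite c b x - Pi.single 0 1) U := by
  rw [plane_eq_plaquetteObs G r, plane_eq_plaquetteObs G r]
  exact plaquetteObs_boxTimeReflect_temporal r c b hj x U

/-- **The corner density after the midplane time reflection**, as plaquette observables of `U`: the three temporal plaquettes one step
below the mirror site plus the three spatial plaquettes at the mirror site. [folklore] -/
theorem dens_boxTimeReflect (c : Fin 4 → ℤ) (b : ℕ) (x : Fin 4 → ℤ) (U : LGConfig 4 G) :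
    dens G r x (boxTimeReflect c b U) =
      (plaquetteObs r.ρ (boxSite c b x - Pi.single 0 1) 0 1 U + plaquetteObs r.ρ (boxSite c b x - Pi.single 0 1) 0 2 U +
        plaquetteObs r.ρ (boxSite c b x - Pi.single 0 1) 0 3 U) +
      (plaquetteObs r.ρ (boxSite c b x) 1 2 U + plaquetteObs r.ρ (boxSite c b x) 1 3 U + plaquetteObs r.ρ (boxSite c b x) 2 3 U) := by
  rw [dens_eq_sum_plaquetteObs]
  simp only [Fin.sum_univ_four, Fin.isValue, show ¬((0 : Fin 4) < 0) from by decide, show ((0 : Fin 4) < 1) from by decide,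
    show ((0 : Fin 4) < 2) from by decide, show ((0 : Fin 4) < 3) from by decide, show ¬((1 : Fin 4) < 0) from by decide,
    show ¬((1 : Fin 4) < 1) from by decide, show ((1 : Fin 4) < 2) from by decide, show ((1 : Fin 4) < 3) from by decide,
    show ¬((2 : Fin 4) < 0) from by decide, show ¬((2 : Fin 4) < 1) from by decide, show ¬((2 : Fin 4) < 2) from by decide,
    show ((2 : Fin 4) < 3) from by decide, show ¬((3 : Fin 4) < 0) from by decide, show ¬((3 : Fin 4) < 1) from by decide,
    show ¬((3 : Fin 4) < 2) from by decide, show ¬((3 : Fin 4) < 3) from by decide, if_true, if_false, add_zero, zero_add]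
  rw [plaquetteObs_boxTimeReflect_temporal r c b (by decide) x U, plaquetteObs_boxTimeReflect_temporal r c b (by decide) x U,
    plaquetteObs_boxTimeReflect_temporal r c b (by decide) x U, plaquetteObs_boxTimeReflect_spatial r c b (by decide) (by decide) x U,
    plaquetteObs_boxTimeReflect_spatial r c b (by decide) (by decide) x U, plaquetteObs_boxTimeReflect_spatial r c b (by decide) (by decide) x U]
  ring

end Planes

end Summit.QuantumFields.YangMills.Cruxes.NT.ClassicalShadow

end
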